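import Summits.CriticalPhenomena.PercolationContinuityZ3.Theorems.Transplant.SkelPhiStepINegOrient
import Summits.CriticalPhenomena.PercolationContinuityZ3.Theorems.Transplant.SkelFrmFromBParamsLF
import Summits.CriticalPhenomena.PercolationContinuityZ3.Theorems.Transplant.SkelFrmBParamsLF
import Summits.CriticalPhenomena.PercolationContinuityZ3.Theorems.Transplant.SkelNegBParamsLF
import Summits.CriticalPhenomena.PercolationContinuityZ3.Theorems.Transplant.SkelFrmFrom1ParamsLO
import Summits.CriticalPhenomena.PercolationContinuityZ3.Theorems.Transplant.SkelFrm1ParamsLO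
import Summits.CriticalPhenomena.PercolationContinuityZ3.Theorems.Transplant.SkelNeg1ParamsLO
import Summits.CriticalPhenomena.PercolationContinuityZ3.Theorems.Transplant.SkelPhiCellsWeakGLevels
import Summits.CriticalPhenomena.PercolationContinuityZ3.Theorems.Transplant.SkelNegBParamsLO
import Summits.CriticalPhenomena.PercolationContinuityZ3.Theorems.Transplant.PlanarSkeletonFrmFromDefs
import Summits.CriticalPhenomena.PercolationContinuityZ3.Theorems.Transplant.PlanarSkeletonFrmDefs
import Summits.CriticalPhenomena.PercolationContinuityZ3.Theorems.Transplant.SkelPhiStepIDataNS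
import HarnessLib
import Summits.CriticalPhenomena.PercolationContinuityZ3.Theorems.Transplant.SkelFrmBParamsLO
/-!
# U-WAVE PORT (RULING D-U, lead g21 2026-08-26; WAVE-U-MANIFEST v3.0 row «SkelFrmBParamsLO» ↦ «SkelFrmFromBParamsLO») of the tree module
# `Transplant/SkelFrmBParamsLO` onto the carrier `PlanarSkeletonFrmFrom` (frames only, cylinders connected from width `ℓ₀` on)

ORIGINAL TITLE: N2 (frames-only node `SamePDropOfSkeletonFrm₁`, OPEN) params column over `PlanarSkeletonFrm` — (ζ″) ledger, shape (B′) of record ((R-14)):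

builds on p205010 (kernel theorem, internal audit signed; external expert review pending) — nothing in this file uses p205010; NOTHING is claimed about the
OPEN node U `SamePDropOfSkeletonFrmFrom₁` (nor U_s / the end state).  Lane `prim-bschramm`, seat `prim-bschramm-p3` gen 26; helper file
(`--supports stmt-CriticalPhenomena-4575 --as helper`).  PORT RULES r1–r4 of RULING D-U: declaration order and proof texts are those of the original,
byte-identical except (i) the carrier token `PlanarSkeletonFrm ↦ PlanarSkeletonFrmFrom` (binders, `namespace`/`end` lines, qualified names of twinned
declarations), (ii) carrier-FREE declarations of the original (φ-level `Skelφ…` blocks and namespace-only arithmetic residents) are NOT re-declared —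
this file imports the original and `export`s the twin-free residents (POLICY T / treatment (m1)); residents whose statement mentions a twinned
constant are copied, (iii) every carrier-binding declaration keeps its explicit binder `(Φ : PlanarSkeletonFrmFrom G)` in its own signature (r2).  Docstrings and citations are the original's.
-/

noncomputable section

open scoped Classical

namespace Summit.CriticalPhenomena.PercolationContinuityZ3.Theorems.Transplant

namespace PlanarSkeletonFrmFrom

namespace NegB

open Literature.Probability.Percolation Literature.Probability.LatticeModels SimpleGraph KNCells
open SkelConc (Consts)
open BoxProdZ2 (ConcRadiiG)
open Skelφ (oriφ trφ)
open Skelφ.StepI (DataN)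
open Neg

section LOLevel

/-! ## §1 The orientation bits and the oriented maps at the two pairs -/

/-- **The long pair's orientation bit** `oL := ori t M_L (n_L f)` (values at the merged record). [this work] -/
def oL (κ : Consts) {V : Type} [DecidableEq V] [Countable V] {G : SimpleGraph V} [G.LocallyFinite] (Φ : PlanarSkeletonFrmFrom G) (t : V) (p : unitInterval) (D : Skelφ.StepI.DataNS V) (DT : DataN V) (ori : V → ℕ → ℕ → Bool) (g : ℕ) (f : ℕ) : Bool := ori t (ML κ Φ t p (D.orient DT ori) g) (nL κ Φ t p (D.orient DT ori) g f)

/-- **The planar map the CELLS read** (long pair): `Φ.φ` or its transpose. [this work] -/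
def φL (κ : Consts) {V : Type} [DecidableEq V] [Countable V] {G : SimpleGraph V} [G.LocallyFinite] (Φ : PlanarSkeletonFrmFrom G) (t : V) (p : unitInterval) (D : Skelφ.StepI.DataNS V) (DT : DataN V) (ori : V → ℕ → ℕ → Bool) (g : ℕ) (f : ℕ) : V → Site 2 := oriφ Φ.φ (oL κ Φ t p D DT ori g f)

/-- **THE FINE WINDOW MAP OF RECORD, ORIENTED**: `fineO := Neg.fine κ Φ t p (orient D DT ori) f φL`. [this work] -/
def fineO (κ : Consts) {V : Type} [DecidableEq V] [Countable V] {G : SimpleGraph V} [G.LocallyFinite] (Φ : PlanarSkeletonFrmFrom G) (t : V) (p : unitInterval) (D : Skelφ.StepI.DataNS V) (DT : DataN V) (ori : V → ℕ → ℕ → Bool) (g : ℕ) (f : ℕ) : V → Site 2 := fine κ Φ t p (D.orient DT ori) g f (φL κ Φ t p D DT ori g f)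

/-- `φL` is 1-Lipschitz. [folklore] -/
theorem lip_φL (κ : Consts) {V : Type} [DecidableEq V] [Countable V] {G : SimpleGraph V} [G.LocallyFinite] (Φ : PlanarSkeletonFrmFrom G) (t : V) (p : unitInterval) (D : Skelφ.StepI.DataNS V) (DT : DataN V) (ori : V → ℕ → ℕ → Bool) (g : ℕ) (f : ℕ) : Skelφ.Lip G (φL κ Φ t p D DT ori g f) := Skelφ.lip_oriφ Φ.lip _

/-- `φL` has unit steps. [folklore] -/
theorem steps_φL (κ : Consts) {V : Type} [DecidableEq V] [Countable V] {G : SimpleGraph V} [G.LocallyFinite] (Φ : PlanarSkeletonFrmFrom G) (t : V) (p : unitInterval) (D : Skelφ.StepI.DataNS V) (DT : DataN V) (ori : V → ℕ → ℕ → Bool) (g : ℕ) (f : ℕ) : Skelφ.Steps G (φL κ Φ t p D DT ori g f) := Skelφ.steps_oriφ Φ.step _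

/-- `fineO` unfolded. [folklore] -/
theorem fineO_eq (κ : Consts) {V : Type} [DecidableEq V] [Countable V] {G : SimpleGraph V} [G.LocallyFinite] (Φ : PlanarSkeletonFrmFrom G) (t : V) (p : unitInterval) (D : Skelφ.StepI.DataNS V) (DT : DataN V) (ori : V → ℕ → ℕ → Bool) (g : ℕ) (f : ℕ) : fineO κ Φ t p D DT ori g f = fine κ Φ t p (D.orient DT ori) g f (φL κ Φ t p D DT ori g f) := rfl

/-! ## §2 The clauses of the two pairs from `FactsO` -/

/-- The two pairs are admissible for the merged record: `M₀ ≤ M_u`, `n₁ M_u ≤ n_s`, `M₀ ≤ M_L`, `n₁ M_L ≤ n_L f`. [folklore] -/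
theorem pairs_adm (κ : Consts) {V : Type} [DecidableEq V] [Countable V] {G : SimpleGraph V} [G.LocallyFinite] (Φ : PlanarSkeletonFrmFrom G) (t : V) (p : unitInterval) (D : Skelφ.StepI.DataNS V) (DT : DataN V) (ori : V → ℕ → ℕ → Bool) (g : ℕ) (f : ℕ) : (D.orient DT ori).M₀ ≤ Mu (D.orient DT ori) ∧ (D.orient DT ori).n₁ (Mu (D.orient DT ori)) ≤ nS (D.orient DT ori) ∧
    (D.orient DT ori).M₀ ≤ ML κ Φ t p (D.orient DT ori) g ∧ (D.orient DT ori).n₁ (ML κ Φ t p (D.orient DT ori) g) ≤ nL κ Φ t p (D.orient DT ori) g f :=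
  ⟨M₀_le_Mu _, n₁_le_nS _, (M₀_le_Mu _).trans (Mu_le_ML κ Φ t p _ g), (n₁L_le_nL κ Φ t p _ g f).1⟩

/-- **THE LONG CLAUSE FROM `FactsO`**: the merged record's geometric clause at the long pair FOR THE ORIENTED MAP `φL`, and the shear bound `|h_L| ≤ 10·n_L`.
[this work] -/
theorem clauseL_of_factsO (κ : Consts) {V : Type} [DecidableEq V] [Countable V] {G : SimpleGraph V} [G.LocallyFinite] (Φ : PlanarSkeletonFrmFrom G) (t : V) (p : unitInterval) (D : Skelφ.StepI.DataNS V) (DT : DataN V) (ori : V → ℕ → ℕ → Bool) (g : ℕ) (f : ℕ) (hR : DT.R = D.R)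
    (hfacts : ∀ M, D.M₀ ≤ M → ∀ n, D.n₁ M ≤ n →
      (ori t M n = true → D.EqGeom G Φ.φ t M n ∧ (D.hgt t M n).natAbs ≤ 10 * n) ∧
      (ori t M n = false → DT.EqGeom G (trφ Φ.φ) t M n ∧ (DT.hgt t M n).natAbs ≤ 10 * n)) :
    (D.orient DT ori).EqGeom G (φL κ Φ t p D DT ori g f) t (ML κ Φ t p (D.orient DT ori) g) (nL κ Φ t p (D.orient DT ori) g f) ∧
      (hL κ Φ t p (D.orient DT ori) g f).natAbs ≤ 10 * nL κ Φ t p (D.orient DT ori) g f := by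
  obtain ⟨-, -, hM, hn⟩ := pairs_adm κ Φ t p D DT ori g f
  exact Skelφ.StepI.orient_clause_all hR hfacts _ hM _ hn

/-- **THE NUMERIC LONG CLAUSE FROM `FactsO`** (what every LF fact consumes). [this work] -/
theorem eqNumL_of_factsO (κ : Consts) {V : Type} [DecidableEq V] [Countable V] {G : SimpleGraph V} [G.LocallyFinite] (Φ : PlanarSkeletonFrmFrom G) (t : V) (p : unitInterval) (D : Skelφ.StepI.DataNS V) (DT : DataN V) (ori : V → ℕ → ℕ → Bool) (g : ℕ) (f : ℕ) (hR : DT.R = D.R)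
    (hfacts : ∀ M, D.M₀ ≤ M → ∀ n, D.n₁ M ≤ n →
      (ori t M n = true → D.EqGeom G Φ.φ t M n ∧ (D.hgt t M n).natAbs ≤ 10 * n) ∧
      (ori t M n = false → DT.EqGeom G (trφ Φ.φ) t M n ∧ (DT.hgt t M n).natAbs ≤ 10 * n)) :
    EqNumL κ Φ t p (D.orient DT ori) g f :=
  eqNumL_of_eqGeom κ Φ t p _ g f _ (clauseL_of_factsO κ Φ t p D DT ori g f hR hfacts).1

/-! ## §3 The scheme-geometry package of the fine cells -/

/-- **THE NINE `GeomHoldsN` CONJUNCTS FOR THE FINE CELLS, map slot `φ′`**: with `Γ := cellGeomSG₂ G (fine … φ′) fcells t Λ`, `FD := faceDataSG …`, `LD := levelDataS …`: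
`Γ.root = t`, `κ.K₀ ≤ Γ.K`, `Lip`, `RunGeom`, `AnchGeom`, `SepGeom₂`, `ExitGeom`, `StepsGeom`, `LevelGeom` — from `Lip G φ′`, `Steps G φ′`, the numeric long clause, `WFS2 fcells Λ`
and the column floor `Nrep (cen x) + 1 ≤ Λ.rQ a x` (hp-8 g33's records over a non-step map + this column's `hψ0/hlip/hws/hcol`). [cite: KozmaNitzan2024, §4 pp. 25–29] -/
theorem geom_fine_at (κ : Consts) {V : Type} [DecidableEq V] [Countable V] {G : SimpleGraph V} [G.LocallyFinite] (Φ : PlanarSkeletonFrmFrom G) (t : V) (p : unitInterval) (D : Skelφ.StepI.DataNS V) (g : ℕ) (f : ℕ) {φ' : V → Site 2} (hlip : Skelφ.Lip G φ') (hstep : Skelφ.Steps G φ') (hN : EqNumL κ Φ t p D g f) {Λ : ConcRadiiG}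
    (hΛ : Skelφ.WFS2 (fcells κ Φ t p D g f) Λ) (hcolQ : ∀ a x, Nrep κ Φ t p D g f ((fcells κ Φ t p D g f).cen x) + 1 ≤ Λ.rQ a x) :
    (Skelφ.cellGeomSG₂ G (fine κ Φ t p D g f φ') (fcells κ Φ t p D g f) t Λ).root = t ∧
      κ.K₀ ≤ (Skelφ.cellGeomSG₂ G (fine κ Φ t p D g f φ') (fcells κ Φ t p D g f) t Λ).K ∧
      Skelφ.Lip G (fine κ Φ t p D g f φ') ∧
      RunGeom G (Skelφ.cellGeomSG₂ G (fine κ Φ t p D g f φ') (fcells κ Φ t p D g f) t Λ) ∧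
      AnchGeom (Skelφ.cellGeomSG₂ G (fine κ Φ t p D g f φ') (fcells κ Φ t p D g f) t Λ) ∧
      SepGeom₂ G (Skelφ.cellGeomSG₂ G (fine κ Φ t p D g f φ') (fcells κ Φ t p D g f) t Λ) ∧
      ExitGeom G (Skelφ.cellGeomSG₂ G (fine κ Φ t p D g f φ') (fcells κ Φ t p D g f) t Λ) ∧
      StepsGeom (Skelφ.cellGeomSG₂ G (fine κ Φ t p D g f φ') (fcells κ Φ t p D g f) t Λ)
        (Skelφ.faceDataSG G (fine κ Φ t p D g f φ') (fcells κ Φ t p D g f) t Λ) ∧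
      LevelGeom G (Skelφ.cellGeomSG₂ G (fine κ Φ t p D g f φ') (fcells κ Φ t p D g f) t Λ)
        (Skelφ.faceDataSG G (fine κ Φ t p D g f φ') (fcells κ Φ t p D g f) t Λ) (Skelφ.levelDataS (fine κ Φ t p D g f φ') (fcells κ Φ t p D g f)) := by
  have hψ0 := fine_base_at κ Φ t p D g f φ' hN
  have hlipψ := lip_fine_at κ Φ t p D g f hlip hN
  have hws := weakSteps_fine_at κ Φ t p D g f hstep hN
  have hcol := hcol_fine_of_sched κ Φ t p D g f hlip hstep hN hcolQ
  refine ⟨rfl, (fcells_K κ Φ t p D g f).2.1, hlipψ, Skelφ.runGeomSG₂ _ _, Skelφ.anchGeomSG₂ _ _, Skelφ.sepGeom₂SG₂ _ _ hΛ hψ0 hlipψ hws hcol,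
    Skelφ.exitGeomSG₂ _ _ hΛ hlipψ, Skelφ.stepsGeomSG₂ _ _ hΛ hlipψ hws, Skelφ.levelGeomSG₂ _ _ hΛ hlipψ⟩

/-- **THE NINE `GeomHoldsNO` CONJUNCTS FOR THE FINE CELLS OF RECORD, ORIENTED** — from `FactsO`'s shared radius and clauses, for every schedule with `WFS2` and the column floor.
[cite: KozmaNitzan2024, §4 pp. 25–29] -/
theorem geom_fineO_of_factsO (κ : Consts) {V : Type} [DecidableEq V] [Countable V] {G : SimpleGraph V} [G.LocallyFinite] (Φ : PlanarSkeletonFrmFrom G) (t : V) (p : unitInterval) (D : Skelφ.StepI.DataNS V) (DT : DataN V) (ori : V → ℕ → ℕ → Bool) (g : ℕ) (f : ℕ) (hR : DT.R = D.R)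
    (hfacts : ∀ M, D.M₀ ≤ M → ∀ n, D.n₁ M ≤ n →
      (ori t M n = true → D.EqGeom G Φ.φ t M n ∧ (D.hgt t M n).natAbs ≤ 10 * n) ∧
      (ori t M n = false → DT.EqGeom G (trφ Φ.φ) t M n ∧ (DT.hgt t M n).natAbs ≤ 10 * n))
    {Λ : ConcRadiiG} (hΛ : Skelφ.WFS2 (fcells κ Φ t p (D.orient DT ori) g f) Λ)
    (hcolQ : ∀ a x, Nrep κ Φ t p (D.orient DT ori) g f ((fcells κ Φ t p (D.orient DT ori) g f).cen x) + 1 ≤ Λ.rQ a x) :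
    (Skelφ.cellGeomSG₂ G (fineO κ Φ t p D DT ori g f) (fcells κ Φ t p (D.orient DT ori) g f) t Λ).root = t ∧
      κ.K₀ ≤ (Skelφ.cellGeomSG₂ G (fineO κ Φ t p D DT ori g f) (fcells κ Φ t p (D.orient DT ori) g f) t Λ).K ∧
      Skelφ.Lip G (fineO κ Φ t p D DT ori g f) ∧
      RunGeom G (Skelφ.cellGeomSG₂ G (fineO κ Φ t p D DT ori g f) (fcells κ Φ t p (D.orient DT ori) g f) t Λ) ∧
      AnchGeom (Skelφ.cellGeomSG₂ G (fineO κ Φ t p D DT ori g f) (fcells κ Φ t p (D.orient DT ori) g f) t Λ) ∧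
      SepGeom₂ G (Skelφ.cellGeomSG₂ G (fineO κ Φ t p D DT ori g f) (fcells κ Φ t p (D.orient DT ori) g f) t Λ) ∧
      ExitGeom G (Skelφ.cellGeomSG₂ G (fineO κ Φ t p D DT ori g f) (fcells κ Φ t p (D.orient DT ori) g f) t Λ) ∧
      StepsGeom (Skelφ.cellGeomSG₂ G (fineO κ Φ t p D DT ori g f) (fcells κ Φ t p (D.orient DT ori) g f) t Λ)
        (Skelφ.faceDataSG G (fineO κ Φ t p D DT ori g f) (fcells κ Φ t p (D.orient DT ori) g f) t Λ) ∧
      LevelGeom G (Skelφ.cellGeomSG₂ G (fineO κ Φ t p D DT ori g f) (fcells κ Φ t p (D.orient DT ori) g f) t Λ)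
        (Skelφ.faceDataSG G (fineO κ Φ t p D DT ori g f) (fcells κ Φ t p (D.orient DT ori) g f) t Λ)
        (Skelφ.levelDataS (fineO κ Φ t p D DT ori g f) (fcells κ Φ t p (D.orient DT ori) g f)) :=
  geom_fine_at κ Φ t p (D.orient DT ori) g f (lip_φL κ Φ t p D DT ori g f) (steps_φL κ Φ t p D DT ori g f) (eqNumL_of_factsO κ Φ t p D DT ori g f hR hfacts) hΛ hcolQ

end LOLevel

end NegB

end PlanarSkeletonFrmFrom

end Summit.CriticalPhenomena.PercolationContinuityZ3.Theorems.Transplant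

end
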